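import Mathlib
import Summits.Ventures.PercRepro2.CutVertexReduction

/-!
# The cut vertex separating the roots, IV: the piece `BBE` in the kernel (blind cell PercRepro2,
p3 g2, 2026-08-25; `proofs/P3-BRIDGE.md` §10.9 — the pilot piece)

The symmetrised piece of the multiset `{B, B, E}` is `4·[P(o, b ∈ C(a₁)) − P(o ∈ C(a₁)) P(b ∈ C(a₁))]`,
nonnegative by Harris (`prob_mul_prob_le_prob_inter`): the three ordered kernels are
`Kt B B E = 0`, `Kt B E B = −1[o ∈ C(a₁)](y)·1[b ∈ C(a₁)](z)`,
`Kt E B B = 2·1[o, b ∈ C(a₁)](z) − 2·1[b ∈ C(a₁)](y) 1[o ∈ C(a₁)](z) + 1[o ∈ C(a₁)](x) 1[b ∈ C(a₁)](y)`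
(`simp` on the glued states), their cubic forms factorise (`triple_sum_sep`), and the `l`-state
coordinates are the cluster indicators of the glued graph (`conn_side`).  The pattern of the other
26 pieces (P3-BRIDGE.md §10.9).  Own work; standard axioms.
-/

namespace Summit.Ventures.PercRepro2

open UnionCluster

namespace CovForm

namespace RootBridge

open OneTyped

section PieceBBE

open Classical

variable {V : Type*} {E : Type*} [Fintype E] [DecidableEq E] {R : Type*}
  [Field R] [LinearOrder R] [IsStrictOrderedRing R]
variable (p : E → R) (ends : E → Sym2 V) (o a₁ a₂ a₃ b c : V) (VL VH : Set V)

omit [LinearOrder R] [IsStrictOrderedRing R] in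
/-- `Kt B B E = 0`. -/
lemma Kt_BBE (l₁ l₂ l₃ : LSt) : (Kt HState.B HState.B HState.E l₁ l₂ l₃ : R) = 0 := by
  simp [Kt, KB, gluedSt, qB, pdB, sigB, uB, St.q', St.Lo, St.Ho, St.Lb, St.Hb, St.L3, St.H3,
    HState.hv, HState.h3, HState.v3, LSt.al, LSt.o1, LSt.b1, LSt.oc, LSt.bc]

omit [LinearOrder R] [IsStrictOrderedRing R] in
/-- `Kt B E B = −1[o₁](y)·1[b₁](z)`. -/
lemma Kt_BEB (l₁ l₂ l₃ : LSt) : (Kt HState.B HState.E HState.B l₁ l₂ l₃ : R) =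
    -((if l₂.2.1 then (1 : R) else 0) * (if l₃.2.2.1 then (1 : R) else 0)) := by
  simp [Kt, KB, gluedSt, qB, pdB, sigB, uB, St.q', St.Lo, St.Ho, St.Lb, St.Hb, St.L3, St.H3,
    HState.hv, HState.h3, HState.v3, LSt.al, LSt.o1, LSt.b1, LSt.oc, LSt.bc]
  split_ifs <;> ring

omit [LinearOrder R] [IsStrictOrderedRing R] in
/-- `Kt E B B = 2·1[o₁b₁](z) − 2·1[b₁](y) 1[o₁](z) + 1[o₁](x) 1[b₁](y)`. -/
lemma Kt_EBB (l₁ l₂ l₃ : LSt) : (Kt HState.E HState.B HState.B l₁ l₂ l₃ : R) =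
    2 * ((if l₃.2.1 then (1 : R) else 0) * (if l₃.2.2.1 then (1 : R) else 0)) -
      2 * ((if l₂.2.2.1 then (1 : R) else 0) * (if l₃.2.1 then (1 : R) else 0)) +
      (if l₁.2.1 then (1 : R) else 0) * (if l₂.2.2.1 then (1 : R) else 0) := by
  simp [Kt, KB, gluedSt, qB, pdB, sigB, uB, St.q', St.Lo, St.Ho, St.Lb, St.Hb, St.L3, St.H3,
    HState.hv, HState.h3, HState.v3, LSt.al, LSt.o1, LSt.b1, LSt.oc, LSt.bc]
  split_ifs <;> ring


/-! ## The `l`-state coordinates are the cluster indicators of the glued graph -/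

omit [Fintype E] [DecidableEq E] [LinearOrder R] [IsStrictOrderedRing R] in
/-- `1[o ∈ C(a₁)]` read off the `l`-state. -/
lemma lst_o1_eq {VL VH : Set V} (h : CutVertex ends o a₁ a₂ a₃ b c VL VH) (x : Config E) :
    (if (lstC ends o a₁ b c VL x).2.1 then (1 : R) else 0) = iL ends a₁ o x := by
  have hsp : ∀ e, x e = true → e ∈ within ends VL ∨ e ∈ within ends VH := fun e _ => h.split e
  have e2 := conn_side ends hsp h.cap h.a1L h.oL
  unfold lstC iL
  simp only [Set.indicator_apply, mem_connEvent, Pi.one_apply]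
  rw [decide_eq_decide.mpr e2.symm]
  · by_cases hc : Conn ends x a₁ o <;> simp [hc]
  all_goals infer_instance

omit [Fintype E] [DecidableEq E] [LinearOrder R] [IsStrictOrderedRing R] in
/-- `1[b ∈ C(a₁)]` read off the `l`-state. -/
lemma lst_b1_eq {VL VH : Set V} (h : CutVertex ends o a₁ a₂ a₃ b c VL VH) (x : Config E) :
    (if (lstC ends o a₁ b c VL x).2.2.1 then (1 : R) else 0) = iL ends a₁ b x := by
  have hsp : ∀ e, x e = true → e ∈ within ends VL ∨ e ∈ within ends VH := fun e _ => h.split e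
  have e4 := conn_side ends hsp h.cap h.a1L h.bL
  unfold lstC iL
  simp only [Set.indicator_apply, mem_connEvent, Pi.one_apply]
  rw [decide_eq_decide.mpr e4.symm]
  · by_cases hc : Conn ends x a₁ b <;> simp [hc]
  all_goals infer_instance

/-! ## The three ordered pieces as polynomials in the atoms -/

omit [LinearOrder R] [IsStrictOrderedRing R] in
/-- `Wt B B E = 0`. -/
lemma Wt_BBE_eq : Wt p ends o a₁ b c VL HState.B HState.B HState.E = 0 := by
  unfold Wt
  simp [Kt_BBE]

omit [LinearOrder R] [IsStrictOrderedRing R] in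
/-- `Wt B E B = −P(o ∈ C(a₁)) P(b ∈ C(a₁))`. -/
lemma Wt_BEB_eq {VL VH : Set V} (h : CutVertex ends o a₁ a₂ a₃ b c VL VH) :
    Wt p ends o a₁ b c VL HState.B HState.E HState.B =
      -(prob p (connEvent ends a₁ o) * prob p (connEvent ends a₁ b)) := by
  unfold Wt
  have e : ∀ x y z : Config E, weight p x * weight p y * weight p z *
      Kt HState.B HState.E HState.B (lstC ends o a₁ b c VL x) (lstC ends o a₁ b c VL y)
        (lstC ends o a₁ b c VL z) =
      weight p x * weight p y * weight p z *
        ((fun _ => (-1 : R)) x * (iL ends a₁ o y * iL ends a₁ b z)) := by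
    intro x y z
    rw [Kt_BEB, lst_o1_eq ends o a₁ a₂ a₃ b c h y, lst_b1_eq ends o a₁ a₂ a₃ b c h z]
    ring
  simp_rw [e]
  rw [triple_sum_sep]
  simp only [expect_const, prob_eq_expect_indicator]
  unfold iL
  ring

omit [LinearOrder R] [IsStrictOrderedRing R] in
/-- `Wt E B B = 2 P(o, b ∈ C(a₁)) − P(o ∈ C(a₁)) P(b ∈ C(a₁))`. -/
lemma Wt_EBB_eq {VL VH : Set V} (h : CutVertex ends o a₁ a₂ a₃ b c VL VH) :
    Wt p ends o a₁ b c VL HState.E HState.B HState.B =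
      2 * prob p (connEvent ends a₁ o ∩ connEvent ends a₁ b) -
        prob p (connEvent ends a₁ o) * prob p (connEvent ends a₁ b) := by
  unfold Wt
  have e : ∀ x y z : Config E, weight p x * weight p y * weight p z *
      Kt HState.E HState.B HState.B (lstC ends o a₁ b c VL x) (lstC ends o a₁ b c VL y)
        (lstC ends o a₁ b c VL z) =
      weight p x * weight p y * weight p z *
        ((fun _ => (2 : R)) x * ((fun _ => (1 : R)) y * (iL ends a₁ o z * iL ends a₁ b z))) -
      weight p x * weight p y * weight p z *
        ((fun _ => (2 : R)) x * (iL ends a₁ b y * iL ends a₁ o z)) +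
      weight p x * weight p y * weight p z *
        (iL ends a₁ o x * (iL ends a₁ b y * (fun _ => (1 : R)) z)) := by
    intro x y z
    rw [Kt_EBB, lst_o1_eq ends o a₁ a₂ a₃ b c h x, lst_b1_eq ends o a₁ a₂ a₃ b c h y,
      lst_o1_eq ends o a₁ a₂ a₃ b c h z, lst_b1_eq ends o a₁ a₂ a₃ b c h z]
    ring
  simp_rw [e, Finset.sum_add_distrib, Finset.sum_sub_distrib]
  rw [triple_sum_sep, triple_sum_sep, triple_sum_sep]
  simp only [expect_const, prob_eq_expect_indicator]
  have hi : (fun z => iL ends a₁ o z * iL ends a₁ b z) =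
      (connEvent ends a₁ o ∩ connEvent ends a₁ b).indicator (1 : Config E → R) := by
    funext z
    unfold iL
    rw [indicator_inter_one]
  rw [hi]
  unfold iL
  ring

/-! ## The piece -/

/-- **The symmetrised piece `{B, B, E}` is `4·[P(o, b ∈ C(a₁)) − P(o ∈ C(a₁)) P(b ∈ C(a₁))] ≥ 0`**
(Harris). -/
theorem Wsym_BBE_nonneg (hp : IsProbVec p) {VL VH : Set V}
    (h : CutVertex ends o a₁ a₂ a₃ b c VL VH) :
    0 ≤ Wsym p ends o a₁ b c VL HState.B HState.B HState.E := by
  unfold Wsym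
  rw [Wt_BBE_eq, Wt_BEB_eq p ends o a₁ a₂ a₃ b c h, Wt_EBB_eq p ends o a₁ a₂ a₃ b c h]
  have hh := prob_mul_prob_le_prob_inter hp (isUpperSet_connEvent ends a₁ o)
    (isUpperSet_connEvent ends a₁ b)
  nlinarith [hh]

end PieceBBE

end RootBridge

end CovForm

end Summit.Ventures.PercRepro2
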